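import Mathlib

/-!
# KPlusLogSqLaw — the COHERENT-WORD AUTOMATON certificate (conjb-2 g15; quarter-turn strip count, door (A′))

Kernel-checked FINITE HEART of THEOREM T3 of `HOME/pub-symmetroid-conjb-2/g15/theory/THEORY-NOTE-g15.md` (paper): for a definite static tridiagonal
`{1,2}` design in continuant form `p_{k+1} = p_k − a_k x^{L_k} p_{k−1}` (`a_k > 0`, `L_k ∈ {±1,±2}`) whose signed word is COHERENT, the rotation `θ` of
`Q(iω) = p_m(iω)` over `ω ∈ (0,∞)` satisfies `−θ ≤ s·π/2` (`s` = number of slow edges `|L_k| = 1`), whence `ρ ≤ (n+s)/2 ≤ m − 1` nonzero zeros in the open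
right half-plane (`HalfTurnStripRowTwo` on the coherent class, every `m`).

What is checked HERE (no analysis): the product automaton of the note §3–§4 — region of the continuant ratio `r_k = p_k/p_{k−1}` on the imaginary axis
(`P, Q1, Q4, R, U, Lo`), jumps `d, d'` of the extreme exponents, signs of the extreme-coefficient ratios — with its letter increments
`−(Rep(∞) − Rep(0+)) − [|L| = 1]` (quarter turns) admits the super-potential `potQL ≤ 0` with `potQL init = 0` on its 34 reachable states (`certQL`,
by `decide`), hence EVERY run has path sum `≤ 0` (`runQL_le`).  Likewise `potLOW` (`θ ≤ 0`), `potSPLP` / `potSPLM` (split laws at `∞` / `0+`).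
The ANALYTIC glue (confinement of `r_k` for all `ω`, the endpoint representative rule, `ρ = n/2 − θ/π`) is paper (note §3–§5), not asserted here.
Nothing in this file is evidence for TropicalB / WeakLifting / Conjecture B.
-/

set_option autoImplicit false
set_option linter.dupNamespace false

namespace Summit.ValiantsHypothesis.ValiantsHypothesis.Theorems.KPlusLogSqLaw.CoherentAutomaton

/-- confinement regions of `r_k(iω)`: positive axis, open quadrants I / IV, open right / upper / lower half-planes. -/
inductive Region | P | Q1 | Q4 | R | U | Lo
  deriving DecidableEq, Repr

/-- edge letters `L = +2, −2, +1, −1`. -/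
inductive Letter | fastUp | fastDown | slowUp | slowDown
  deriving DecidableEq, Repr

namespace Letter
/-- the signed log-slope. -/
def val : Letter → Int | fastUp => 2 | fastDown => -2 | slowUp => 1 | slowDown => -1
/-- indicator of a slow edge. -/
def slow : Letter → Int | slowUp => 1 | slowDown => 1 | _ => 0
/-- indicator of `L = +1`. -/
def slowUpInd : Letter → Int | slowUp => 1 | _ => 0
/-- indicator of `L = −1`. -/
def slowDownInd : Letter → Int | slowDown => 1 | _ => 0
end Letter

/-- all letters. -/
def letters : List Letter := [.fastUp, .fastDown, .slowUp, .slowDown]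

/-- `letters` is exhaustive. -/
theorem mem_letters (L : Letter) : L ∈ letters := by cases L <;> decide

/-- the region transition of `r ↦ 1 + c/r` (`c > 0` for fast letters, `c = −iγ` for `+1`, `c = +iγ` for `−1`); `none` = DEAD (`{Re z < 1}`). -/
def tr : Region → Letter → Option Region
  | .P, .fastUp => some .P   | .P, .fastDown => some .P   | .P, .slowUp => some .Q4  | .P, .slowDown => some .Q1
  | .Q1, .fastUp => some .Q4 | .Q1, .fastDown => some .Q4 | .Q1, .slowUp => some .Lo | .Q1, .slowDown => some .Q1
  | .Q4, .fastUp => some .Q1 | .Q4, .fastDown => some .Q1 | .Q4, .slowUp => some .Q4 | .Q4, .slowDown => some .U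
  | .R, .fastUp => some .R   | .R, .fastDown => some .R   | .R, .slowUp => some .Lo  | .R, .slowDown => some .U
  | .U, .fastUp => some .Lo  | .U, .fastDown => some .Lo  | .U, .slowUp => none      | .U, .slowDown => some .R
  | .Lo, .fastUp => some .U  | .Lo, .fastDown => some .U  | .Lo, .slowUp => some .R  | .Lo, .slowDown => none

/-- lower end of the region's angular interval, in quarter turns. -/
def lo : Region → Int | .P => 0 | .Q1 => 0 | .Q4 => -1 | .R => -1 | .U => 0 | .Lo => -2
/-- upper end of the region's angular interval, in quarter turns. -/
def hi : Region → Int | .P => 0 | .Q1 => 1 | .Q4 => 0 | .R => 1 | .U => 2 | .Lo => 0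

/-- the representative of the angle `t` (quarter turns, mod 4) in the CLOSED angular interval of the region, if any. -/
def rep (t : Int) (H : Region) : Option Int :=
  let x := lo H + (t - lo H) % 4
  if x ≤ hi H then some x else none

/-- automaton state at a site: region of `r_k`, top-exponent jump `d ∈ {0,1,2}`, bottom-exponent jump `dp ∈ {0,−1,−2}`,
sign of `c_top(k)/c_top(k−1)` (`true` = positive), sign of `c_bot(k)/c_bot(k−1)`. -/
structure St where
  H : Region
  d : Int
  dp : Int
  sg : Bool
  sgp : Bool
  deriving DecidableEq, Repr

/-- initial state (site 1: `r_1 = 1`). -/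
def init : St := ⟨.P, 0, 0, true, true⟩

/-- successors of the top data `(d, sign)`: strict decrease keeps the old top (`+`), strict increase negates the sign, a tie is `+` after a negative
sign and FREE after a positive one. -/
def tops (s : St) (L : Letter) : List (Int × Bool) :=
  let de := L.val - s.d
  if de < 0 then [(0, true)] else if 0 < de then [(de, !s.sg)] else if s.sg then [(0, true), (0, false)] else [(0, true)]

/-- successors of the bottom data (mirror rules). -/
def bots (s : St) (L : Letter) : List (Int × Bool) :=
  let de := L.val - s.dp
  if 0 < de then [(0, true)] else if de < 0 then [(de, !s.sgp)] else if s.sgp then [(0, true), (0, false)] else [(0, true)]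

/-- candidate successors with their endpoint arguments `(Rep(∞), Rep(0+))` in quarter turns (`none` components = no representative). -/
def cands (s : St) (L : Letter) : List (St × Option Int × Option Int) :=
  match tr s.H L with
  | none => []
  | some H2 =>
    (tops s L).flatMap fun t =>
      (bots s L).map fun b =>
        (⟨H2, t.1, b.1, t.2, b.2⟩, rep (t.1 + (if t.2 then 0 else 2)) H2, rep (b.1 + (if b.2 then 0 else 2)) H2)

/-- the transitions: successor state with `ai = lim_{ω→∞} arg r` and `a0 = lim_{ω→0+} arg r` (quarter turns). -/
def step (s : St) (L : Letter) : List (St × Int × Int) :=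
  (cands s L).filterMap fun c =>
    match c.2.1, c.2.2 with
    | some ai, some a0 => some (c.1, ai, a0)
    | _, _ => none

/-- the 34 reachable states. -/
def reach : List St :=
  [⟨.Lo, 0, -1, true, true⟩,
   ⟨.Lo, 0, -2, true, false⟩,
   ⟨.Lo, 0, -2, true, true⟩,
   ⟨.Lo, 0, 0, false, true⟩,
   ⟨.Lo, 0, 0, true, true⟩,
   ⟨.Lo, 1, 0, false, true⟩,
   ⟨.Lo, 2, 0, false, true⟩,
   ⟨.P, 0, -2, true, false⟩,
   ⟨.P, 0, 0, true, true⟩,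
   ⟨.P, 2, 0, false, true⟩,
   ⟨.Q1, 0, -1, true, false⟩,
   ⟨.Q1, 0, -2, true, false⟩,
   ⟨.Q1, 0, 0, true, true⟩,
   ⟨.Q1, 1, 0, true, true⟩,
   ⟨.Q1, 2, 0, false, true⟩,
   ⟨.Q4, 0, -1, true, true⟩,
   ⟨.Q4, 0, -2, true, false⟩,
   ⟨.Q4, 0, 0, true, true⟩,
   ⟨.Q4, 1, 0, false, true⟩,
   ⟨.Q4, 2, 0, false, true⟩,
   ⟨.R, 0, -1, true, false⟩,
   ⟨.R, 0, -1, true, true⟩,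
   ⟨.R, 0, -2, true, false⟩,
   ⟨.R, 0, 0, true, true⟩,
   ⟨.R, 1, 0, false, true⟩,
   ⟨.R, 1, 0, true, true⟩,
   ⟨.R, 2, 0, false, true⟩,
   ⟨.U, 0, -1, true, false⟩,
   ⟨.U, 0, -2, true, false⟩,
   ⟨.U, 0, 0, true, false⟩,
   ⟨.U, 0, 0, true, true⟩,
   ⟨.U, 1, 0, true, true⟩,
   ⟨.U, 2, 0, false, true⟩,
   ⟨.U, 2, 0, true, true⟩]

/-- the initial state is reachable. -/
theorem init_mem_reach : init ∈ reach := by decide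

/-- no candidate transition out of a reachable state lacks a representative (the sign/exponent patterns are all compatible with confinement). -/
theorem cands_total : ∀ s ∈ reach, ∀ L ∈ letters, ∀ c ∈ cands s L, c.2.1.isSome ∧ c.2.2.isSome := by decide

/-- a run from state `s`: list of steps `(letter, successor, Rep(∞), Rep(0+))`, each a transition of `step` (Boolean validity check). -/
def valid : St → List (Letter × St × Int × Int) → Bool
  | _, [] => true
  | s, (L, s', ai, a0) :: w => decide ((s', ai, a0) ∈ step s L) && valid s' w

/-- path sum of an increment functional along a run. -/
def psum (f : Letter → Int → Int → Int) : List (Letter × St × Int × Int) → Int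
  | [] => 0
  | (L, _, ai, a0) :: w => f L ai a0 + psum f w

/-- increment of the functional `QL` for a step with endpoint arguments `ai = Rep(∞)`, `a0 = Rep(0+)` (quarter turns). -/
def incQL : Letter → Int → Int → Int := fun L ai a0 => -(ai - a0) - L.slow

/-- super-potential for `incQL` (longest-path values on the reachable states). -/
def potQL : St → Int := fun s =>
  match (reach.zip [-1, 0, -2, 0, 0, 0, 0, 0, 0, 0, 0, 0, 0, -1, 0, -1, 0, 0, 0, 0, 0, -1, 0, 0, 0, -1, 0, 0, 0, 0, 0, -1, 0, -2]).find? (fun q => q.1 = s) with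
  | some q => q.2
  | none => 0

/-- the potential vanishes at `init`. -/
theorem potQL_init : potQL init = 0 := by decide

/-- the potential is nonpositive on every reachable state. -/
theorem potQL_nonpos : ∀ s ∈ reach, potQL s ≤ 0 := by decide

/-- CERTIFICATE (`decide`): reachability is closed under `step` and `potQL` is a super-potential for `incQL`. -/
theorem certQL : ∀ s ∈ reach, ∀ L ∈ letters, ∀ p ∈ step s L,
    p.1 ∈ reach ∧ potQL s + incQL L p.2.1 p.2.2 ≤ potQL p.1 := by decide

/-- potential bookkeeping along a valid run from a reachable state. -/
theorem runQL_aux : ∀ (w : List (Letter × St × Int × Int)) (s : St), s ∈ reach → valid s w = true → potQL s + psum incQL w ≤ 0 := by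
  intro w
  induction w with
  | nil => intro s hs _; simpa [psum] using potQL_nonpos s hs
  | cons x w ih =>
      obtain ⟨L, s', ai, a0⟩ := x
      intro s hs hv
      have hv2 : (s', ai, a0) ∈ step s L ∧ valid s' w = true := by
        simpa [valid, Bool.and_eq_true, decide_eq_true_eq] using hv
      obtain ⟨hmem, hv'⟩ := hv2
      have hc := certQL s hs L (mem_letters L) _ hmem
      have h1 := ih s' hc.1 hv'
      have h2 := hc.2
      dsimp only at h2
      simp only [psum]
      omega

/-- every run of the coherent-word automaton from `init` has `QL`-path-sum `≤ 0`. -/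
theorem runQL_le (w : List (Letter × St × Int × Int)) (h : valid init w = true) : psum incQL w ≤ 0 := by
  have := runQL_aux w init init_mem_reach h
  rw [potQL_init] at this
  simpa using this

/-- increment of the functional `LOW` for a step with endpoint arguments `ai = Rep(∞)`, `a0 = Rep(0+)` (quarter turns). -/
def incLOW : Letter → Int → Int → Int := fun _ ai a0 => (ai - a0)

/-- super-potential for `incLOW` (longest-path values on the reachable states). -/
def potLOW : St → Int := fun s =>
  match (reach.zip [0, 0, 0, -2, 0, -1, 0, 0, 0, 0, -1, 0, 0, 0, 0, 0, 0, 0, -1, 0, -1, 0, 0, 0, -1, 0, 0, -1, 0, -2, 0, 0, 0, 0]).find? (fun q => q.1 = s) with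
  | some q => q.2
  | none => 0

/-- the potential vanishes at `init`. -/
theorem potLOW_init : potLOW init = 0 := by decide

/-- the potential is nonpositive on every reachable state. -/
theorem potLOW_nonpos : ∀ s ∈ reach, potLOW s ≤ 0 := by decide

/-- CERTIFICATE (`decide`): reachability is closed under `step` and `potLOW` is a super-potential for `incLOW`. -/
theorem certLOW : ∀ s ∈ reach, ∀ L ∈ letters, ∀ p ∈ step s L,
    p.1 ∈ reach ∧ potLOW s + incLOW L p.2.1 p.2.2 ≤ potLOW p.1 := by decide

/-- potential bookkeeping along a valid run from a reachable state. -/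
theorem runLOW_aux : ∀ (w : List (Letter × St × Int × Int)) (s : St), s ∈ reach → valid s w = true → potLOW s + psum incLOW w ≤ 0 := by
  intro w
  induction w with
  | nil => intro s hs _; simpa [psum] using potLOW_nonpos s hs
  | cons x w ih =>
      obtain ⟨L, s', ai, a0⟩ := x
      intro s hs hv
      have hv2 : (s', ai, a0) ∈ step s L ∧ valid s' w = true := by
        simpa [valid, Bool.and_eq_true, decide_eq_true_eq] using hv
      obtain ⟨hmem, hv'⟩ := hv2
      have hc := certLOW s hs L (mem_letters L) _ hmem
      have h1 := ih s' hc.1 hv'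
      have h2 := hc.2
      dsimp only at h2
      simp only [psum]
      omega

/-- every run of the coherent-word automaton from `init` has `LOW`-path-sum `≤ 0`. -/
theorem runLOW_le (w : List (Letter × St × Int × Int)) (h : valid init w = true) : psum incLOW w ≤ 0 := by
  have := runLOW_aux w init init_mem_reach h
  rw [potLOW_init] at this
  simpa using this

/-- increment of the functional `SPLP` for a step with endpoint arguments `ai = Rep(∞)`, `a0 = Rep(0+)` (quarter turns). -/
def incSPLP : Letter → Int → Int → Int := fun L ai _ => -ai - L.slowUpInd

/-- super-potential for `incSPLP` (longest-path values on the reachable states). -/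
def potSPLP : St → Int := fun s =>
  match (reach.zip [0, 0, 0, 0, 0, 0, 0, 0, 0, 0, 0, 0, 0, -1, 0, 0, 0, 0, 0, 0, 0, 0, 0, 0, 0, -1, 0, 0, 0, 0, 0, -1, 0, -2]).find? (fun q => q.1 = s) with
  | some q => q.2
  | none => 0

/-- the potential vanishes at `init`. -/
theorem potSPLP_init : potSPLP init = 0 := by decide

/-- the potential is nonpositive on every reachable state. -/
theorem potSPLP_nonpos : ∀ s ∈ reach, potSPLP s ≤ 0 := by decide

/-- CERTIFICATE (`decide`): reachability is closed under `step` and `potSPLP` is a super-potential for `incSPLP`. -/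
theorem certSPLP : ∀ s ∈ reach, ∀ L ∈ letters, ∀ p ∈ step s L,
    p.1 ∈ reach ∧ potSPLP s + incSPLP L p.2.1 p.2.2 ≤ potSPLP p.1 := by decide

/-- potential bookkeeping along a valid run from a reachable state. -/
theorem runSPLP_aux : ∀ (w : List (Letter × St × Int × Int)) (s : St), s ∈ reach → valid s w = true → potSPLP s + psum incSPLP w ≤ 0 := by
  intro w
  induction w with
  | nil => intro s hs _; simpa [psum] using potSPLP_nonpos s hs
  | cons x w ih =>
      obtain ⟨L, s', ai, a0⟩ := x
      intro s hs hv
      have hv2 : (s', ai, a0) ∈ step s L ∧ valid s' w = true := by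
        simpa [valid, Bool.and_eq_true, decide_eq_true_eq] using hv
      obtain ⟨hmem, hv'⟩ := hv2
      have hc := certSPLP s hs L (mem_letters L) _ hmem
      have h1 := ih s' hc.1 hv'
      have h2 := hc.2
      dsimp only at h2
      simp only [psum]
      omega

/-- every run of the coherent-word automaton from `init` has `SPLP`-path-sum `≤ 0`. -/
theorem runSPLP_le (w : List (Letter × St × Int × Int)) (h : valid init w = true) : psum incSPLP w ≤ 0 := by
  have := runSPLP_aux w init init_mem_reach h
  rw [potSPLP_init] at this
  simpa using this

/-- increment of the functional `SPLM` for a step with endpoint arguments `ai = Rep(∞)`, `a0 = Rep(0+)` (quarter turns). -/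
def incSPLM : Letter → Int → Int → Int := fun L _ a0 => a0 - L.slowDownInd

/-- super-potential for `incSPLM` (longest-path values on the reachable states). -/
def potSPLM : St → Int := fun s =>
  match (reach.zip [-1, 0, -2, 0, 0, 0, 0, 0, 0, 0, 0, 0, 0, 0, 0, -1, 0, 0, 0, 0, 0, -1, 0, 0, 0, 0, 0, 0, 0, 0, 0, 0, 0, 0]).find? (fun q => q.1 = s) with
  | some q => q.2
  | none => 0

/-- the potential vanishes at `init`. -/
theorem potSPLM_init : potSPLM init = 0 := by decide

/-- the potential is nonpositive on every reachable state. -/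
theorem potSPLM_nonpos : ∀ s ∈ reach, potSPLM s ≤ 0 := by decide

/-- CERTIFICATE (`decide`): reachability is closed under `step` and `potSPLM` is a super-potential for `incSPLM`. -/
theorem certSPLM : ∀ s ∈ reach, ∀ L ∈ letters, ∀ p ∈ step s L,
    p.1 ∈ reach ∧ potSPLM s + incSPLM L p.2.1 p.2.2 ≤ potSPLM p.1 := by decide

/-- potential bookkeeping along a valid run from a reachable state. -/
theorem runSPLM_aux : ∀ (w : List (Letter × St × Int × Int)) (s : St), s ∈ reach → valid s w = true → potSPLM s + psum incSPLM w ≤ 0 := by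
  intro w
  induction w with
  | nil => intro s hs _; simpa [psum] using potSPLM_nonpos s hs
  | cons x w ih =>
      obtain ⟨L, s', ai, a0⟩ := x
      intro s hs hv
      have hv2 : (s', ai, a0) ∈ step s L ∧ valid s' w = true := by
        simpa [valid, Bool.and_eq_true, decide_eq_true_eq] using hv
      obtain ⟨hmem, hv'⟩ := hv2
      have hc := certSPLM s hs L (mem_letters L) _ hmem
      have h1 := ih s' hc.1 hv'
      have h2 := hc.2
      dsimp only at h2
      simp only [psum]
      omega

/-- every run of the coherent-word automaton from `init` has `SPLM`-path-sum `≤ 0`. -/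
theorem runSPLM_le (w : List (Letter × St × Int × Int)) (h : valid init w = true) : psum incSPLM w ≤ 0 := by
  have := runSPLM_aux w init init_mem_reach h
  rw [potSPLM_init] at this
  simpa using this

end Summit.ValiantsHypothesis.ValiantsHypothesis.Theorems.KPlusLogSqLaw.CoherentAutomaton
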